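import Summits.NavierStokesRegularity.NavierStokesRegularity.Theorems.PerpetualPumpAveragedTypeIBlowupLevelOnePreTools
import Mathlib.Topology.Order.Lattice

/-!
# Crux `PerpetualPump.AveragedTypeIBlowup` (stmt-NavierStokesRegularity-1835), line `Sketch`:
# stub `levelOnePre` — the level-1 carrier/bond pair of the front before ignition

This file proves the registered stub `stub_levelOnePre` (Mathlib-only) of the line skeleton
`Cruxes/AveragedTypeIBlowup/Lines/Sketch.lean`. Data, in the slow time `σ` of the front (all rates
in units of the front rate; the level-1 pair runs at relative rate `q⁴`, `q ∈ [1, 21/20]`):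
the next carrier `x' = q⁴(-x + w²/q³ - y² - ε̄ x y) + eₓ`, fed only by the pre-ignition front bond
`w` (`w² ≤ Bx/100` pointwise, `∫₀^σ w² ≤ Iw ≤ 1/50`), the next bond
`y' = q⁴(y (x - x₂/q - 1) + ε̄ x²) + e_y` (a residual carrier `|x₂| ≤ 1/2` above), memory errors
`|eₓ| ≤ η q⁴ mx`, `|e_y| ≤ η q⁴ my` controlled by Duhamel majorants in restart form
`m(σ) ≤ m(0) e^{-θq⁴σ} + q⁴ ∫₀^σ e^{-θq⁴(σ-u)} |G(u)| du` (`θ ∈ [1/2, 1]`) of the brackets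
`Gₓ = w²/q³ - y² - ε̄ x y`, `G_y = y (x - x₂/q) + ε̄ x²`, with `ε̄ ≤ 10⁻⁶`, `η Bx ≤ 10⁻⁴`, and seeds
`|x(0)|, |y(0)|, mx(0), my(0) ≤ ε̄`. Conclusion: on `[0, T]`,
`|x| ≤ ε̄ + q Iw + 10⁻³`, `|y| ≤ (11/10) ε̄`, `mx ≤ ε̄ + Bx/40`, `my ≤ 4 ε̄`.

Proof (a bootstrap, Mathlib only; tools in `…LevelOnePreTools.lean`, `…TrailPairTools.lean`).
* `levelOnePre_majorants` — under the loose box `|x| ≤ 1/20`, `|y| ≤ 2ε̄` on `[0, T]`: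
  `|Gₓ| ≤ Bx/100 + ε̄/100` and `|G_y| ≤ (11/10)ε̄ + ε̄/400`, and the kernel gain is
  `q⁴/(θq⁴) = 1/θ ≤ 2`, so `mx ≤ ε̄ + Bx/40`, `my ≤ 4ε̄`.
* `levelOnePre_core` — the loose box `|x| ≤ 1/20`, `|y| ≤ 2ε̄`, `mx ≤ ε̄ + Bx/20`, `my ≤ 8ε̄`
  on `[0, T]` implies the four tight bounds (`levelOnePre_carrier`, `levelOnePre_bond`,
  `levelOnePre_majorants`).
* `stub_levelOnePre` — the loose box holds at `σ = 0` and is strictly improved by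
  `levelOnePre_core` on any initial segment where it holds, so it holds on `[0, T]` by continuous
  induction (`trailPair_realInduction`); the conclusions follow.

## References

* T. Tao, *Finite time blowup for an averaged three-dimensional Navier–Stokes equation*, J. Amer.
  Math. Soc. 29 (2016), 601–674, §5–6 (the pre-ignition bookkeeping is a folklore ODE bootstrap).
-/

noncomputable section

-- the summit namespace `…NavierStokesRegularity.NavierStokesRegularity…` is the tree convention
set_option linter.dupNamespace false

open MeasureTheory Set Filter Topology

namespace Summit.NavierStokesRegularity.NavierStokesRegularity.Theorems.PerpetualPumpAveragedTypeIBlowup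

/-- **Pre-ignition majorants under the bootstrap box.** If `|x| ≤ 1/20` and `|y| ≤ 2ε̄` on
`[0, T]` (with `|x₂| ≤ 1/2`, `w² ≤ Bx/100`, `q ≥ 1`, `ε̄ ≤ 10⁻⁶ ≤ Bx/4`), then the brackets obey
`|w²/q³ - y² - ε̄xy| ≤ Bx/100 + ε̄/100` and `|y(x - x₂/q) + ε̄x²| ≤ (11/10)ε̄ + ε̄/400`, so the
restart-form majorants (rate `θq⁴`, prefactor `q⁴`, gain `1/θ ≤ 2`, seeds `≤ ε̄`) obey
`mx ≤ ε̄ + Bx/40` and `my ≤ 4ε̄` on `[0, T]`. [folklore] -/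
theorem levelOnePre_majorants {x y w x2 mx my : ℝ → ℝ} {q θ εb Bx T : ℝ}
    (hq1 : 1 ≤ q) (hθ : 1 / 2 ≤ θ) (hεb : 0 < εb) (hεb1 : εb ≤ 1 / 10 ^ 6) (hBx : 1 ≤ Bx)
    (hT : 0 ≤ T) (hx : ContinuousOn x (Icc 0 T)) (hy : ContinuousOn y (Icc 0 T))
    (hw : ContinuousOn w (Icc 0 T)) (hx2 : ContinuousOn x2 (Icc 0 T))
    (hmx : ∀ σ ∈ Icc 0 T, 0 ≤ mx σ ∧ mx σ ≤ mx 0 * Real.exp (-(θ * q ^ 4 * σ)) +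
      q ^ 4 * ∫ u in (0 : ℝ)..σ, Real.exp (-(θ * q ^ 4 * (σ - u))) *
        |(w u) ^ 2 / q ^ 3 - (y u) ^ 2 - εb * x u * y u|)
    (hmy : ∀ σ ∈ Icc 0 T, 0 ≤ my σ ∧ my σ ≤ my 0 * Real.exp (-(θ * q ^ 4 * σ)) +
      q ^ 4 * ∫ u in (0 : ℝ)..σ, Real.exp (-(θ * q ^ 4 * (σ - u))) *
        |y u * (x u - x2 u / q) + εb * (x u) ^ 2|)
    (hwB : ∀ σ ∈ Icc 0 T, (w σ) ^ 2 ≤ Bx / 100) (hx2b : ∀ σ ∈ Icc 0 T, |x2 σ| ≤ 1 / 2)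
    (hmx0 : mx 0 ≤ εb) (hmy0 : my 0 ≤ εb)
    (hQ : ∀ σ ∈ Icc 0 T, |x σ| ≤ 1 / 20 ∧ |y σ| ≤ 2 * εb) :
    ∀ σ ∈ Icc 0 T, mx σ ≤ εb + Bx / 40 ∧ my σ ≤ 4 * εb := by
  have hqpos : 0 < q := by linarith
  have hqne : q ≠ 0 := hqpos.ne'
  have hq3 : 1 ≤ q ^ 3 := one_le_pow₀ hq1
  have hq4pos : 0 < q ^ 4 := by positivity
  have hθpos : 0 < θ := by linarith
  have hθne : θ ≠ 0 := hθpos.ne'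
  have hκ : 0 < θ * q ^ 4 := mul_pos hθpos hq4pos
  have hεbsq : εb * εb ≤ εb * (1 / 10 ^ 6) := mul_le_mul_of_nonneg_left hεb1 hεb.le
  have h0T : (0 : ℝ) ∈ Icc 0 T := left_mem_Icc.2 hT
  have hE1 : ∀ {σ : ℝ}, 0 ≤ σ → Real.exp (-(θ * q ^ 4 * σ)) ≤ 1 := fun hσ =>
    Real.exp_le_one_iff.2 (neg_nonpos.2 (mul_nonneg hκ.le hσ))
  have hgain : ∀ {C : ℝ}, 0 ≤ C → q ^ 4 * (C / (θ * q ^ 4)) ≤ 2 * C := fun {C} hC => by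
    have h1 : q ^ 4 * (C / (θ * q ^ 4)) = C / θ := by field_simp
    have h2 : C / θ ≤ C / (1 / 2) := div_le_div_of_nonneg_left hC (by norm_num) hθ
    rw [h1]
    linarith
  -- the carrier bracket
  have hGx : ∀ u ∈ Icc 0 T,
      |(w u) ^ 2 / q ^ 3 - (y u) ^ 2 - εb * x u * y u| ≤ Bx / 100 + εb / 100 := by
    intro u hu
    obtain ⟨hxu, hyu⟩ := hQ u hu
    have h1 : 0 ≤ (w u) ^ 2 / q ^ 3 := by positivity
    have h2 : (w u) ^ 2 / q ^ 3 ≤ (w u) ^ 2 := div_le_self (sq_nonneg _) hq3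
    have h3 := hwB u hu
    have hy' := abs_le.1 hyu
    have h4 : (y u) ^ 2 ≤ (2 * εb) ^ 2 := sq_le_sq' (by linarith) hy'.2
    have h4e : (2 * εb) ^ 2 = 4 * (εb * εb) := by ring
    have h5 : |x u * y u| ≤ 1 / 20 * (2 * εb) := by
      rw [abs_mul]
      exact mul_le_mul hxu hyu (abs_nonneg _) (by norm_num)
    have h6 : εb * (x u * y u) ≤ εb * (1 / 20 * (2 * εb)) :=
      mul_le_mul_of_nonneg_left (abs_le.1 h5).2 hεb.le
    have h7 : εb * -(1 / 20 * (2 * εb)) ≤ εb * (x u * y u) :=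
      mul_le_mul_of_nonneg_left (abs_le.1 h5).1 hεb.le
    have h8 := sq_nonneg (y u)
    rw [abs_le]
    constructor <;> linarith
  -- the bond bracket
  have hGy : ∀ u ∈ Icc 0 T,
      |y u * (x u - x2 u / q) + εb * (x u) ^ 2| ≤ 11 / 10 * εb + εb / 400 := by
    intro u hu
    obtain ⟨hxu, hyu⟩ := hQ u hu
    have hq' : |x2 u / q| ≤ 1 / 2 := by
      rw [abs_div, abs_of_pos hqpos]
      exact (div_le_self (abs_nonneg _) hq1).trans (hx2b u hu)
    have hq'' := abs_le.1 hq'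
    have hx' := abs_le.1 hxu
    have h1 : |x u - x2 u / q| ≤ 11 / 20 := by
      rw [abs_le]
      constructor <;> linarith
    have h2 : |y u * (x u - x2 u / q)| ≤ 2 * εb * (11 / 20) := by
      rw [abs_mul]
      exact mul_le_mul hyu h1 (abs_nonneg _) (by positivity)
    have h3 : (x u) ^ 2 ≤ (1 / 20) ^ 2 := sq_le_sq' hx'.1 hx'.2
    have h4 : 0 ≤ εb * (x u) ^ 2 := by positivity
    have h5 : εb * (x u) ^ 2 ≤ εb * (1 / 20) ^ 2 := mul_le_mul_of_nonneg_left h3 hεb.le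
    have h6 := abs_le.1 h2
    rw [abs_le]
    constructor <;> linarith
  intro σ hσ
  have hsub : Icc 0 σ ⊆ Icc 0 T := Icc_subset_Icc_right hσ.2
  constructor
  · have hg : ContinuousOn (fun u => (w u) ^ 2 / q ^ 3 - (y u) ^ 2 - εb * x u * y u) (Icc 0 σ) :=
      ((((hw.pow 2).div_const (q ^ 3)).sub (hy.pow 2)).sub
        (((continuousOn_const (c := εb)).mul hx).mul hy)).mono hsub
    have h := levelOnePre_majorant hκ (by positivity) hq4pos.le hσ.1 hg
      (fun u hu => hGx u (hsub hu)) (hmx σ hσ).2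
    have h2 := hgain (C := Bx / 100 + εb / 100) (by positivity)
    have h3 : mx 0 * Real.exp (-(θ * q ^ 4 * σ)) ≤ εb :=
      (mul_le_of_le_one_right (hmx 0 h0T).1 (hE1 hσ.1)).trans hmx0
    linarith
  · have hg : ContinuousOn (fun u => y u * (x u - x2 u / q) + εb * (x u) ^ 2) (Icc 0 σ) :=
      ((hy.mul (hx.sub (hx2.div_const q))).add
        ((continuousOn_const (c := εb)).mul (hx.pow 2))).mono hsub
    have h := levelOnePre_majorant hκ (by positivity) hq4pos.le hσ.1 hg
      (fun u hu => hGy u (hsub hu)) (hmy σ hσ).2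
    have h2 := hgain (C := 11 / 10 * εb + εb / 400) (by positivity)
    have h3 : my 0 * Real.exp (-(θ * q ^ 4 * σ)) ≤ εb :=
      (mul_le_of_le_one_right (hmy 0 h0T).1 (hE1 hσ.1)).trans hmy0
    linarith

/-- **The pre-ignition estimates under the bootstrap hypothesis.** If, in addition to the
hypotheses of `stub_levelOnePre`, the loose a-priori box `|x| ≤ 1/20`, `|y| ≤ 2ε̄`,
`mx ≤ ε̄ + Bx/20`, `my ≤ 8ε̄` holds on `[0, T]`, then the tight bounds
`|x| ≤ ε̄ + q Iw + 10⁻³`, `|y| ≤ (11/10) ε̄`, `mx ≤ ε̄ + Bx/40`, `my ≤ 4ε̄` hold on `[0, T]`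
(`levelOnePre_carrier`, `levelOnePre_bond`, `levelOnePre_majorants`). [folklore] -/
theorem levelOnePre_core {x y w x2 mx my ex ey : ℝ → ℝ} {q θ η εb Bx Iw T : ℝ}
    (hq1 : 1 ≤ q) (hθ : 1 / 2 ≤ θ) (hη : 0 ≤ η) (hεb : 0 < εb) (hεb1 : εb ≤ 1 / 10 ^ 6)
    (hBx : 1 ≤ Bx) (hηBx : η * Bx ≤ 1 / 10 ^ 4) (hIw : 0 ≤ Iw) (hT : 0 ≤ T)
    (hx : ContinuousOn x (Icc 0 T)) (hy : ContinuousOn y (Icc 0 T))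
    (hw : ContinuousOn w (Icc 0 T)) (hx2 : ContinuousOn x2 (Icc 0 T))
    (hdx : ∀ σ ∈ Ioo 0 T, HasDerivAt x
      (q ^ 4 * (-(x σ) + (w σ) ^ 2 / q ^ 3 - (y σ) ^ 2 - εb * x σ * y σ) + ex σ) σ)
    (hdy : ∀ σ ∈ Ioo 0 T, HasDerivAt y
      (q ^ 4 * (y σ * (x σ - x2 σ / q - 1) + εb * (x σ) ^ 2) + ey σ) σ)
    (hexb : ∀ σ ∈ Icc 0 T, |ex σ| ≤ η * q ^ 4 * mx σ)
    (heyb : ∀ σ ∈ Icc 0 T, |ey σ| ≤ η * q ^ 4 * my σ)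
    (hmx : ∀ σ ∈ Icc 0 T, 0 ≤ mx σ ∧ mx σ ≤ mx 0 * Real.exp (-(θ * q ^ 4 * σ)) +
      q ^ 4 * ∫ u in (0 : ℝ)..σ, Real.exp (-(θ * q ^ 4 * (σ - u))) *
        |(w u) ^ 2 / q ^ 3 - (y u) ^ 2 - εb * x u * y u|)
    (hmy : ∀ σ ∈ Icc 0 T, 0 ≤ my σ ∧ my σ ≤ my 0 * Real.exp (-(θ * q ^ 4 * σ)) +
      q ^ 4 * ∫ u in (0 : ℝ)..σ, Real.exp (-(θ * q ^ 4 * (σ - u))) *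
        |y u * (x u - x2 u / q) + εb * (x u) ^ 2|)
    (hwB : ∀ σ ∈ Icc 0 T, (w σ) ^ 2 ≤ Bx / 100)
    (hwI : ∀ σ ∈ Icc 0 T, ∫ u in (0 : ℝ)..σ, (w u) ^ 2 ≤ Iw)
    (hx2b : ∀ σ ∈ Icc 0 T, |x2 σ| ≤ 1 / 2)
    (hx0 : |x 0| ≤ εb) (hy0 : |y 0| ≤ εb) (hmx0 : mx 0 ≤ εb) (hmy0 : my 0 ≤ εb)
    (hQ : ∀ σ ∈ Icc 0 T, |x σ| ≤ 1 / 20 ∧ |y σ| ≤ 2 * εb ∧ mx σ ≤ εb + Bx / 20 ∧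
      my σ ≤ 8 * εb) :
    ∀ σ ∈ Icc 0 T, |x σ| ≤ εb + q * Iw + 1 / 10 ^ 3 ∧ |y σ| ≤ 11 / 10 * εb ∧
      mx σ ≤ εb + Bx / 40 ∧ my σ ≤ 4 * εb := by
  intro σ hσ
  have hm := levelOnePre_majorants hq1 hθ hεb hεb1 hBx hT hx hy hw hx2 hmx hmy hwB hx2b hmx0 hmy0
    (fun t ht => ⟨(hQ t ht).1, (hQ t ht).2.1⟩) σ hσ
  exact ⟨levelOnePre_carrier hq1 hη hεb hεb1 hBx hηBx hIw hT hx hw hdx hexb hwI hx0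
      (fun t ht => ⟨(hQ t ht).1, (hQ t ht).2.1, (hQ t ht).2.2.1⟩) σ hσ,
    levelOnePre_bond hq1 hη hεb hBx hηBx hT hx hy hx2 hdy heyb hx2b hy0
      (fun t ht => ⟨(hQ t ht).1, (hQ t ht).2.2.2⟩) σ hσ, hm.1, hm.2⟩

/-- **Registered stub `stub_levelOnePre`** (line `Sketch` of crux `PerpetualPump.AveragedTypeIBlowup`,
stmt-NavierStokesRegularity-1835): THE LEVEL-1 PAIR BEFORE IGNITION, in the slow time of the front
(rate `q⁴`, `q ∈ [1, 21/20]`): the next carrier `x' = q⁴(-x + w²/q³ - y² - ε̄xy) + eₓ` is fed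
only by the pre-ignition front bond (`w² ≤ Bx/100`, `∫w² ≤ Iw ≤ 1/50`) and stays
`|x| ≤ ε̄ + q·Iw + 10⁻³`; the next bond `y' = q⁴(y(x - x₂/q - 1) + ε̄x²) + e_y` is damped
(`|x₂| ≤ 1/2`) and stays `|y| ≤ (11/10)ε̄`; the restart-form majorants (relative errors `η`,
`ηBx ≤ 10⁻⁴`) stay `mx ≤ ε̄ + Bx/40`, `my ≤ 4ε̄`. Proof: the loose box `|x| ≤ 1/20`, `|y| ≤ 2ε̄`,
`mx ≤ ε̄ + Bx/20`, `my ≤ 8ε̄` holds at `σ = 0` and is strictly improved by `levelOnePre_core` on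
every initial segment where it holds, hence holds on `[0, T]` by continuous induction
(`trailPair_realInduction`); then `levelOnePre_core` on `[0, T]`. [folklore] -/
theorem stub_levelOnePre :
    ∀ (x y w x2 mx my ex ey : ℝ → ℝ) (q θ η εb Bx Iw T : ℝ),
      1 ≤ q → q ≤ 21 / 20 → 1 / 2 ≤ θ → θ ≤ 1 → 0 ≤ η → 0 < εb → εb ≤ 1 / 10 ^ 6 →
      1 ≤ Bx → η * Bx ≤ 1 / 10 ^ 4 → 0 ≤ Iw → Iw ≤ 1 / 50 → 0 ≤ T → T ≤ 4 →
      ContinuousOn x (Icc 0 T) → ContinuousOn y (Icc 0 T) → ContinuousOn w (Icc 0 T) →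
      ContinuousOn x2 (Icc 0 T) → ContinuousOn mx (Icc 0 T) → ContinuousOn my (Icc 0 T) →
      ContinuousOn ex (Icc 0 T) → ContinuousOn ey (Icc 0 T) →
      (∀ σ ∈ Ioo 0 T, HasDerivAt x
        (q ^ 4 * (-(x σ) + (w σ) ^ 2 / q ^ 3 - (y σ) ^ 2 - εb * x σ * y σ) + ex σ) σ) →
      (∀ σ ∈ Ioo 0 T, HasDerivAt y
        (q ^ 4 * (y σ * (x σ - x2 σ / q - 1) + εb * (x σ) ^ 2) + ey σ) σ) →
      (∀ σ ∈ Icc 0 T, |ex σ| ≤ η * q ^ 4 * mx σ) → (∀ σ ∈ Icc 0 T, |ey σ| ≤ η * q ^ 4 * my σ) →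
      (∀ σ ∈ Icc 0 T, 0 ≤ mx σ ∧ mx σ ≤ mx 0 * Real.exp (-(θ * q ^ 4 * σ)) +
        q ^ 4 * ∫ u in (0 : ℝ)..σ, Real.exp (-(θ * q ^ 4 * (σ - u))) *
          |(w u) ^ 2 / q ^ 3 - (y u) ^ 2 - εb * x u * y u|) →
      (∀ σ ∈ Icc 0 T, 0 ≤ my σ ∧ my σ ≤ my 0 * Real.exp (-(θ * q ^ 4 * σ)) +
        q ^ 4 * ∫ u in (0 : ℝ)..σ, Real.exp (-(θ * q ^ 4 * (σ - u))) *
          |y u * (x u - x2 u / q) + εb * (x u) ^ 2|) →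
      (∀ σ ∈ Icc 0 T, (w σ) ^ 2 ≤ Bx / 100) → (∀ σ ∈ Icc 0 T, ∫ u in (0 : ℝ)..σ, (w u) ^ 2 ≤ Iw) →
      (∀ σ ∈ Icc 0 T, |x2 σ| ≤ 1 / 2) →
      |x 0| ≤ εb → |y 0| ≤ εb → mx 0 ≤ εb → my 0 ≤ εb →
      ∀ σ ∈ Icc 0 T, |x σ| ≤ εb + q * Iw + 1 / 10 ^ 3 ∧ |y σ| ≤ 11 / 10 * εb ∧
        mx σ ≤ εb + Bx / 40 ∧ my σ ≤ 4 * εb := by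
  intro x y w x2 mx my ex ey q θ η εb Bx Iw T hq1 hq2 hθ _hθ1 hη hεb hεb1 hBx hηBx hIw hIw1 hT _hT4
    hx hy hw hx2 hmxc hmyc _hex _hey hdx hdy hexb heyb hmx hmy hwB hwI hx2b hx0 hy0 hmx0 hmy0
  -- the bootstrap: the loose box holds on all of `[0, T]`
  have hQ : ∀ σ ∈ Icc 0 T, |x σ| ≤ 1 / 20 ∧ |y σ| ≤ 2 * εb ∧ mx σ ≤ εb + Bx / 20 ∧
      my σ ≤ 8 * εb := by
    have hf : ContinuousOn (fun u => max (max (|x u| - 1 / 20) (|y u| - 2 * εb))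
        (max (mx u - (εb + Bx / 20)) (my u - 8 * εb))) (Icc 0 T) :=
      (((continuous_abs.comp_continuousOn hx).sub continuousOn_const).sup
        ((continuous_abs.comp_continuousOn hy).sub continuousOn_const)).sup
        ((hmxc.sub continuousOn_const).sup (hmyc.sub continuousOn_const))
    have h0 : max (max (|x 0| - 1 / 20) (|y 0| - 2 * εb))
        (max (mx 0 - (εb + Bx / 20)) (my 0 - 8 * εb)) ≤ 0 :=
      max_le (max_le (by linarith) (by linarith)) (max_le (by linarith) (by linarith))
    have hstep : ∀ τ ∈ Icc 0 T, (∀ u ∈ Icc 0 τ, max (max (|x u| - 1 / 20) (|y u| - 2 * εb))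
        (max (mx u - (εb + Bx / 20)) (my u - 8 * εb)) ≤ 0) →
        max (max (|x τ| - 1 / 20) (|y τ| - 2 * εb))
          (max (mx τ - (εb + Bx / 20)) (my τ - 8 * εb)) < 0 := by
      intro τ hτ hu
      have hQτ : ∀ u ∈ Icc 0 τ, |x u| ≤ 1 / 20 ∧ |y u| ≤ 2 * εb ∧ mx u ≤ εb + Bx / 20 ∧
          my u ≤ 8 * εb := by
        intro u hu'
        have h := hu u hu'
        simp only [max_le_iff] at h
        obtain ⟨⟨h1, h2⟩, h3, h4⟩ := h
        exact ⟨by linarith, by linarith, by linarith, by linarith⟩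
      have hsub : Icc 0 τ ⊆ Icc 0 T := Icc_subset_Icc_right hτ.2
      have hsub' : Ioo 0 τ ⊆ Ioo 0 T := Ioo_subset_Ioo_right hτ.2
      obtain ⟨h1, h2, h3, h4⟩ := levelOnePre_core hq1 hθ hη hεb hεb1 hBx hηBx hIw hτ.1
        (hx.mono hsub) (hy.mono hsub) (hw.mono hsub) (hx2.mono hsub)
        (fun t ht => hdx t (hsub' ht)) (fun t ht => hdy t (hsub' ht))
        (fun t ht => hexb t (hsub ht)) (fun t ht => heyb t (hsub ht))
        (fun t ht => hmx t (hsub ht)) (fun t ht => hmy t (hsub ht))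
        (fun t ht => hwB t (hsub ht)) (fun t ht => hwI t (hsub ht))
        (fun t ht => hx2b t (hsub ht)) hx0 hy0 hmx0 hmy0 hQτ τ (right_mem_Icc.2 hτ.1)
      have hqIw : q * Iw ≤ 21 / 20 * (1 / 50) := mul_le_mul hq2 hIw1 hIw (by norm_num)
      exact max_lt (max_lt (by linarith) (by linarith)) (max_lt (by linarith) (by linarith))
    intro σ hσ
    have h := trailPair_realInduction hf h0 hstep σ hσ
    simp only [max_le_iff] at h
    obtain ⟨⟨h1, h2⟩, h3, h4⟩ := h
    exact ⟨by linarith, by linarith, by linarith, by linarith⟩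
  exact levelOnePre_core hq1 hθ hη hεb hεb1 hBx hηBx hIw hT hx hy hw hx2 hdx hdy hexb heyb hmx hmy
    hwB hwI hx2b hx0 hy0 hmx0 hmy0 hQ

end Summit.NavierStokesRegularity.NavierStokesRegularity.Theorems.PerpetualPumpAveragedTypeIBlowup

end
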